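import Mathlib

/-!
# Crux `LevyNegativeMoment` (stmt-AtomisticToContinuum-9115), line `registered`, stub `stub_rieszSum` —
# part C: the folded coordinate `t ↦ t̄ = min(t mod m, m - t mod m)` on `ℤ/m`

Helper file (lead prover of the line) for the L-free grid Riesz sum bound (stub `stub_rieszSum`).  The
amplitude of the one-dimensional character sums is `F t = g(t̄)`, `t̄ = min (t % m) (m - t % m)` (distance to `mℤ`).
This file is the finite combinatorics of `t̄`:

* `t̄` is `m`-periodic and `1`-Lipschitz along `t ↦ t+1` (`bar_succ_cases`);
* every level `v` is crossed at most twice per period by consecutive bars (`card_filter_min_bar_le_two`,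
  `card_filter_min_bar_succ_le_two`), so sums of `e(min(t̄, (t+1)‾))` over a period are at most twice the sum of
  `e` over the levels (`sum_fiber_le_two_mul_sum`);
* the three-point stencils `{t̄, (t+1)‾, (t+2)‾}` are `{c-1, c, c+1}` away from the top level `M₀ = ⌊m/2⌋`
  (`bar_stencil_of_ne_top`) and lie in `{M₀-1, M₀}` at the top (`bar_stencil_of_eq_top`), the top being hit at
  most twice (`card_filter_bar_succ_eq_top_le_two`);
* consequence: the cyclic total variation of `t ↦ g(t̄)` over a period is at most `2(|g 1 - g 0| + g 1)` for
  `g ≥ 0` antitone on `[1, ∞)` (`cyclicTV_le`).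
-/

namespace Summit.AtomisticToContinuum.BoseEinsteinCondensation.Cruxes.LevyNegativeMoment.Birth.Riesz

open scoped BigOperators
open Finset

/-! ## Residues of `t+1`, `t+2` -/

/-- For `t < m`: the residues of `t`, `t+1`, `t+2` modulo `m` (`m ≥ 2`), as linear-arithmetic facts. [folklore] -/
theorem mod_cases {m t : ℕ} (ht : t < m) (hm : 2 ≤ m) :
    t % m = t ∧ (((t + 1) % m = t + 1 ∧ t + 1 < m) ∨ ((t + 1) % m = 0 ∧ t + 1 = m)) ∧
      (((t + 2) % m = t + 2 ∧ t + 2 < m) ∨ ((t + 2) % m = t + 2 - m ∧ m ≤ t + 2)) := by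
  refine ⟨Nat.mod_eq_of_lt ht, ?_, ?_⟩
  · rcases lt_or_ge (t + 1) m with h | h
    · exact Or.inl ⟨Nat.mod_eq_of_lt h, h⟩
    · have : t + 1 = m := by omega
      exact Or.inr ⟨by rw [this, Nat.mod_self], this⟩
  · rcases lt_or_ge (t + 2) m with h | h
    · exact Or.inl ⟨Nat.mod_eq_of_lt h, h⟩
    · refine Or.inr ⟨?_, h⟩
      rw [Nat.mod_eq_sub_mod h, Nat.mod_eq_of_lt (by omega)]

/-- `t̄` is `m`-periodic. [folklore] -/
theorem bar_add_period (m t : ℕ) :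
    min ((t + m) % m) (m - (t + m) % m) = min (t % m) (m - t % m) := by
  rw [Nat.add_mod_right]

/-- Consecutive bars differ by at most one: `(t+1)‾ ∈ {t̄ - 1, t̄, t̄ + 1}`. [folklore] -/
theorem bar_succ_cases {m t : ℕ} (hm : 2 ≤ m) :
    min ((t + 1) % m) (m - (t + 1) % m) = min (t % m) (m - t % m) + 1 ∨
      min ((t + 1) % m) (m - (t + 1) % m) + 1 = min (t % m) (m - t % m) ∨
        min ((t + 1) % m) (m - (t + 1) % m) = min (t % m) (m - t % m) := by
  have hm0 : 0 < m := by omega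
  -- reduce to t < m
  rw [← Nat.mod_add_div t m]
  set r := t % m with hr
  have hr' : r < m := Nat.mod_lt _ hm0
  have e1 : (r + m * (t / m) + 1) % m = (r + 1) % m := by
    rw [show r + m * (t / m) + 1 = (r + 1) + m * (t / m) by ring, Nat.add_mul_mod_self_left]
  have e0 : (r + m * (t / m)) % m = r % m := by rw [Nat.add_mul_mod_self_left]
  rw [e1, e0]
  obtain ⟨h0, h1, -⟩ := mod_cases hr' hm
  rcases h1 with ⟨e1, l1⟩ | ⟨e1, l1⟩ <;> simp only [h0, e1] <;> omega

/-- The fibers of `t ↦ min(t̄, (t+1)‾)` over one period have at most two elements. [folklore] -/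
theorem card_filter_min_bar_le_two {m : ℕ} (hm : 2 ≤ m) (v : ℕ) :
    ((range m).filter (fun t => min (min (t % m) (m - t % m))
      (min ((t + 1) % m) (m - (t + 1) % m)) = v)).card ≤ 2 := by
  have hsub : (range m).filter (fun t => min (min (t % m) (m - t % m))
      (min ((t + 1) % m) (m - (t + 1) % m)) = v) ⊆ {v, m - 1 - v} := by
    intro t ht
    simp only [mem_filter, mem_range] at ht
    simp only [mem_insert, mem_singleton]
    obtain ⟨h0, h1, -⟩ := mod_cases ht.1 hm
    rcases h1 with ⟨e1, l1⟩ | ⟨e1, l1⟩ <;> simp only [h0, e1] at ht ⊢ <;> omega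
  exact (card_le_card hsub).trans (card_le_two)

/-- The fibers of `t ↦ min((t+1)‾, (t+2)‾)` over one period have at most two elements. [folklore] -/
theorem card_filter_min_bar_succ_le_two {m : ℕ} (hm : 2 ≤ m) (v : ℕ) :
    ((range m).filter (fun t => min (min ((t + 1) % m) (m - (t + 1) % m))
      (min ((t + 2) % m) (m - (t + 2) % m)) = v)).card ≤ 2 := by
  rcases Nat.eq_zero_or_pos v with hv | hv
  · have hsub : (range m).filter (fun t => min (min ((t + 1) % m) (m - (t + 1) % m))
        (min ((t + 2) % m) (m - (t + 2) % m)) = v) ⊆ {m - 1, m - 2} := by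
      intro t ht
      simp only [mem_filter, mem_range] at ht
      simp only [mem_insert, mem_singleton]
      obtain ⟨h0, h1, h2⟩ := mod_cases ht.1 hm
      rcases h1 with ⟨e1, l1⟩ | ⟨e1, l1⟩ <;> rcases h2 with ⟨e2, l2⟩ | ⟨e2, l2⟩ <;>
        simp only [e1, e2] at ht ⊢ <;> omega
    exact (card_le_card hsub).trans (card_le_two)
  · have hsub : (range m).filter (fun t => min (min ((t + 1) % m) (m - (t + 1) % m))
        (min ((t + 2) % m) (m - (t + 2) % m)) = v) ⊆ {v - 1, m - 2 - v} := by
      intro t ht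
      simp only [mem_filter, mem_range] at ht
      simp only [mem_insert, mem_singleton]
      obtain ⟨h0, h1, h2⟩ := mod_cases ht.1 hm
      rcases h1 with ⟨e1, l1⟩ | ⟨e1, l1⟩ <;> rcases h2 with ⟨e2, l2⟩ | ⟨e2, l2⟩ <;>
        simp only [e1, e2] at ht ⊢ <;> omega
    exact (card_le_card hsub).trans (card_le_two)

/-- The top level `M₀ = m/2` is the middle bar of at most two stencils per period. [folklore] -/
theorem card_filter_bar_succ_eq_top_le_two {m : ℕ} (hm : 2 ≤ m) :
    ((range m).filter (fun t => min ((t + 1) % m) (m - (t + 1) % m) = m / 2)).card ≤ 2 := by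
  have hsub : (range m).filter (fun t => min ((t + 1) % m) (m - (t + 1) % m) = m / 2)
      ⊆ {m / 2 - 1, m - m / 2 - 1} := by
    intro t ht
    simp only [mem_filter, mem_range] at ht
    simp only [mem_insert, mem_singleton]
    obtain ⟨h0, h1, -⟩ := mod_cases ht.1 hm
    rcases h1 with ⟨e1, l1⟩ | ⟨e1, l1⟩ <;> simp only [e1] at ht ⊢ <;> omega
  exact (card_le_card hsub).trans (card_le_two)

/-- Stencils away from the top: if the middle bar `c = (t+1)‾` is not `M₀ = m/2` (`m ≥ 3`), then the outer
bars are `{c-1, c+1}` (or both `1` when `c = 0`). [folklore] -/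
theorem bar_stencil_of_ne_top {m t : ℕ} (hm : 3 ≤ m) (ht : t < m)
    (hc : min ((t + 1) % m) (m - (t + 1) % m) ≠ m / 2) :
    (min (t % m) (m - t % m) + 1 = min ((t + 1) % m) (m - (t + 1) % m) ∧
        min ((t + 2) % m) (m - (t + 2) % m) = min ((t + 1) % m) (m - (t + 1) % m) + 1) ∨
      (min (t % m) (m - t % m) = min ((t + 1) % m) (m - (t + 1) % m) + 1 ∧
        min ((t + 2) % m) (m - (t + 2) % m) + 1 = min ((t + 1) % m) (m - (t + 1) % m)) ∨
      (min ((t + 1) % m) (m - (t + 1) % m) = 0 ∧ min (t % m) (m - t % m) = 1 ∧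
        min ((t + 2) % m) (m - (t + 2) % m) = 1) := by
  obtain ⟨h0, h1, h2⟩ := mod_cases ht (by omega)
  rcases h1 with ⟨e1, l1⟩ | ⟨e1, l1⟩ <;> rcases h2 with ⟨e2, l2⟩ | ⟨e2, l2⟩ <;>
    simp only [h0, e1, e2] at hc ⊢ <;> omega

/-- Stencils at the top: if `(t+1)‾ = M₀` (`m ≥ 3`) then `t̄, (t+2)‾ ∈ {M₀ - 1, M₀}`. [folklore] -/
theorem bar_stencil_of_eq_top {m t : ℕ} (hm : 3 ≤ m) (ht : t < m)
    (hc : min ((t + 1) % m) (m - (t + 1) % m) = m / 2) :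
    (min (t % m) (m - t % m) = m / 2 - 1 ∨ min (t % m) (m - t % m) = m / 2) ∧
      (min ((t + 2) % m) (m - (t + 2) % m) = m / 2 - 1 ∨
        min ((t + 2) % m) (m - (t + 2) % m) = m / 2) := by
  obtain ⟨h0, h1, h2⟩ := mod_cases ht (by omega)
  rcases h1 with ⟨e1, l1⟩ | ⟨e1, l1⟩ <;> rcases h2 with ⟨e2, l2⟩ | ⟨e2, l2⟩ <;>
    simp only [h0, e1, e2] at hc ⊢ <;> omega

/-- Bars never exceed `M₀ = m/2`. [folklore] -/
theorem bar_le_half (m t : ℕ) : min (t % m) (m - t % m) ≤ m / 2 := by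
  rcases Nat.eq_zero_or_pos m with hm | hm
  · subst hm; simp
  · have := Nat.mod_lt t hm
    omega

/-! ## Fiber summation -/

/-- If every fiber of `φ : s → ℕ` has at most two points and `φ ≤ N`, then
`Σ_{t∈s} e(φ t) ≤ 2 Σ_{v ≤ N} e v` for `e ≥ 0`. [folklore] -/
theorem sum_fiber_le_two_mul_sum {s : Finset ℕ} {φ : ℕ → ℕ} {e : ℕ → ℝ} (he : ∀ v, 0 ≤ e v)
    {N : ℕ} (hφ : ∀ t ∈ s, φ t ≤ N) (hfib : ∀ v, (s.filter (fun t => φ t = v)).card ≤ 2) :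
    ∑ t ∈ s, e (φ t) ≤ 2 * ∑ v ∈ range (N + 1), e v := by
  have hmaps : ∀ t ∈ s, φ t ∈ range (N + 1) := fun t ht => mem_range.mpr (Nat.lt_succ_of_le (hφ t ht))
  rw [← sum_fiberwise_of_maps_to hmaps (fun t => e (φ t)), mul_sum]
  refine sum_le_sum fun v _ => ?_
  have : ∑ t ∈ s with φ t = v, e (φ t) = ∑ t ∈ s with φ t = v, e v :=
    sum_congr rfl fun t ht => by rw [(mem_filter.mp ht).2]
  rw [this, sum_const, nsmul_eq_mul]
  calc ((s.filter (fun t => φ t = v)).card : ℝ) * e v ≤ 2 * e v := by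
        have : ((s.filter (fun t => φ t = v)).card : ℝ) ≤ 2 := by exact_mod_cast hfib v
        exact mul_le_mul_of_nonneg_right this (he v)

/-! ## The cyclic total variation of `t ↦ g(t̄)` -/

/-- One step of `t ↦ g(t̄)` costs at most `|g(v+1) - g v|` at the level `v = min(t̄, (t+1)‾)`. [folklore] -/
theorem abs_step_le {m : ℕ} (hm : 2 ≤ m) (g : ℝ → ℝ) (t : ℕ) :
    |g (min ((t + 1) % m) (m - (t + 1) % m) : ℕ) - g (min (t % m) (m - t % m) : ℕ)| ≤
      |g ((min (min (t % m) (m - t % m)) (min ((t + 1) % m) (m - (t + 1) % m)) : ℕ) + 1)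
        - g (min (min (t % m) (m - t % m)) (min ((t + 1) % m) (m - (t + 1) % m)) : ℕ)| := by
  rcases bar_succ_cases (t := t) hm with h | h | h
  · rw [h, min_eq_left (Nat.le_succ _)]
    push_cast
    exact le_rfl
  · rw [← h, min_eq_right (Nat.le_succ _), abs_sub_comm]
    push_cast
    exact le_rfl
  · rw [h, sub_self, abs_zero]
    exact abs_nonneg _

/-- **Cyclic total variation.** For `g ≥ 0` on `ℕ` and antitone on `[1, ∞)`:
`Σ_{t<m} |g((t+1)‾) - g(t̄)| ≤ 2(|g 1 - g 0| + g 1)` (`m ≥ 2`). [folklore] -/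
theorem cyclicTV_le {m : ℕ} (hm : 2 ≤ m) {g : ℝ → ℝ} (hg0 : ∀ n : ℕ, 0 ≤ g n)
    (hga : AntitoneOn g (Set.Ici 1)) :
    ∑ t ∈ range m, |g (min ((t + 1) % m) (m - (t + 1) % m) : ℕ) - g (min (t % m) (m - t % m) : ℕ)|
      ≤ 2 * (|g 1 - g 0| + g 1) := by
  set e : ℕ → ℝ := fun v => |g ((v : ℕ) + 1 : ℝ) - g v| with he
  have step1 : ∑ t ∈ range m,
      |g (min ((t + 1) % m) (m - (t + 1) % m) : ℕ) - g (min (t % m) (m - t % m) : ℕ)|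
        ≤ ∑ t ∈ range m,
          e (min (min (t % m) (m - t % m)) (min ((t + 1) % m) (m - (t + 1) % m))) := by
    refine sum_le_sum fun t _ => ?_
    simpa [he] using abs_step_le hm g t
  have step2 : ∑ t ∈ range m, e (min (min (t % m) (m - t % m)) (min ((t + 1) % m) (m - (t + 1) % m)))
      ≤ 2 * ∑ v ∈ range (m / 2 + 1), e v := by
    refine sum_fiber_le_two_mul_sum (fun v => (abs_nonneg _ : 0 ≤ e v)) (fun t _ => ?_)
      (card_filter_min_bar_le_two hm)
    exact (min_le_left _ _).trans (bar_le_half m t)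
  have step3 : ∑ v ∈ range (m / 2 + 1), e v ≤ |g 1 - g 0| + g 1 := by
    rw [sum_range_succ']
    simp only [he, Nat.cast_zero, zero_add, Nat.cast_succ]
    -- Σ_{v < m/2} |g(v+2) - g(v+1)| + |g 1 - g 0|
    have htel : ∑ v ∈ range (m / 2), |g ((v : ℝ) + 1 + 1) - g ((v : ℝ) + 1)|
        = ∑ v ∈ range (m / 2), (g ((v : ℝ) + 1) - g ((v : ℝ) + 1 + 1)) := by
      refine sum_congr rfl fun v _ => ?_
      rw [abs_sub_comm, abs_of_nonneg]
      have h := hga (show ((v : ℝ) + 1) ∈ Set.Ici (1 : ℝ) by simp)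
        (show ((v : ℝ) + 1 + 1) ∈ Set.Ici (1 : ℝ) by
          simp only [Set.mem_Ici]; have : (0:ℝ) ≤ v := by positivity
          linarith)
        (by linarith)
      linarith
    have htel2 : ∑ v ∈ range (m / 2), (g ((v : ℝ) + 1) - g ((v : ℝ) + 1 + 1))
        = g 1 - g ((m / 2 : ℕ) + 1) := by
      have := sum_range_sub' (fun v : ℕ => g ((v : ℝ) + 1)) (m / 2)
      simp only [Nat.cast_zero, zero_add, Nat.cast_succ] at this
      convert this using 2
    rw [htel, htel2]
    have : 0 ≤ g ((m / 2 : ℕ) + 1) := by exact_mod_cast hg0 (m / 2 + 1)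
    linarith
  calc _ ≤ _ := step1
    _ ≤ 2 * ∑ v ∈ range (m / 2 + 1), e v := step2
    _ ≤ 2 * (|g 1 - g 0| + g 1) := by gcongr

end Summit.AtomisticToContinuum.BoseEinsteinCondensation.Cruxes.LevyNegativeMoment.Birth.Riesz
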